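import Summits.NavierStokesRegularity.NavierStokesRegularity.Theorems.FilamentSkeletonRssSkeletonJ1RSplit
import Summits.NavierStokesRegularity.NavierStokesRegularity.Theorems.FilamentSkeletonRssNormalBlockMatchedL
import Summits.NavierStokesRegularity.NavierStokesRegularity.Theorems.FilamentSkeletonRssClause13RImp

/-!
# Route `FilamentSkeletonRss` · crux `SkeletonJ1R` (stmt-NavierStokesRegularity-23610) · LINE `lia_switchoff_degree_R`
# (crux-strategist cstrat-23610-0, 2026-08-29) — EXISTENCE BY TOPOLOGY IN THE LIA-REFERENCE FRAME:
# inflating switch-on + Leray–Schauder index + a priori confinement, with the a priori CLASSES and the outer MODEL centred on the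
# CURVED local-induction (LIA) reference skeleton instead of on the straight datum lines.

HEADER: see `Lines/lia_switchoff_degree_R.md` (the line card).  MECHANISM = the registered line `switchoff_degree_R` (crux-strategist r1-0,
sha 45b2ee91d7d0…; credited in full): fixed-point INDEX of the compact unstable-streamline map of the SELF-GENERATED switched field
`σ_s·(u_X + ½y − αe₃×y) + (1−σ_s)·M`, homotopy = inflating the switched-on ball, a priori CONFINEMENT of EXACT switched-tangent skeletons
in place of any right inverse of the linearised tangency operator.

WHAT IS CORRECTED (the reason this line exists).  Exact tangency on the crux ball `‖y‖ ≤ ℓ = Rb√(Γ log Γ)` forces every filament to carry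
the odd, strain-driven S-BEND of local induction: with `β_j = Γγ_j log Γ/(8π)` (matched unit core) the normal component `−ατ·(e₃×t_j)` of the
frame strain along the arm is balanced only by `β_j x′×x″`, so `x_j(τ) − (waist + τ t_j) ≈ −(ατ³/6β_j)(e₃)⊥`, i.e. a normal displacement
`≈ (A/3)·Rb³·√(log Γ)·√Γ` at the ball edge (`A = 4πα|e₃×t_j|/γ_j`, the programme's own turning formula) — UNBOUNDED in units of `√Γ`.
The registered classes `CoarseClass`/`FineClass` are tubes of FIXED radius `ρ√Γ/8`, `Rb√Γ` about the STRAIGHT datum lines for ALL `τ`, so for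
`log Γ ≳ (12ρ/(√2·A·Rb³))²` (resp. `(12/(√2·A·Rb²))²`) they contain no exactly tangent skeleton at `s = 1`: granted the Leray–Schauder
alternative `LeraySchauderSwitchOn`, the registered `Confinement` is FALSE as typed for every fixed `Rb` and all large `Γ` (the crux quantifies
`∀ Γ ≥ Γ₂`).  The crux itself is untouched (it allows curvature `K/√Γ`, i.e. `O(1)` total turning), and so is the mechanism.
THE FIX: (1) the a priori classes COARSE / FINE are SHADOWING TUBES about a REFERENCE SKELETON `x` (position `ρ√Γ/16`,
`Rb√Γ`; tilt `Rb/2`, `Rb/4` against the reference tangent), and the outer model `M` is the hyperbolic arm model written in the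
normal-disc coordinates OF THE REFERENCE, `M(x_j(τ) + z) = (7/4)τ·x_j′(τ) − λz` (so the reference is the model's unstable streamline
through its waist zero and the normal contraction `λ` SELECTS the exit data of a switched-tangent skeleton: a `C¹` streamline entering
the pure-model region off the reference must carry the model's slope `−λz/((7/4)τ)` — two conditions per arm end = the four free
parameters of the in-ball local-induction family); (2) the FRAME `(x, M)` is CHOSEN BY THE CONFINEMENT PROVER (`∃` in `ConfinementL`,
`∀` in the Leray–Schauder and output stubs), constrained only by what those consumers use (`AdmissibleFrame`: unit-speed `C²`
references through the datum waists with tilt `≤ Rb/8` against the datum directions, curvature `√Γ‖x″‖ ≤ Rb/2`, separation `(ρ/2)√Γ`,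
injective normal tubes of radius `ρ√Γ/8`; a `C²` model of linear growth equal to the arm model in the tubes), and it is CONSTANT along
the homotopy — only the switched-on ball inflates.  THE INTENDED FRAME (line card §Idea; companion file
`Lines/lia_switchoff_degree_R_frame.lean` types it as `IsLiaReference`) is the LOCAL-INDUCTION (LIA / binormal) REFERENCE: the unit-speed
curves shot from the scaled datum waists `√Γ(p_j + s₀_j t_j)` in the directions `t_j` solving `x_j″ = β_j⁻¹·φ(x_j)·x_j′ × W_j(x_j)` with
`W_j` = regularised Biot–Savart field (unit cores) of the OTHER scaled straight datum lines `+ ½y − αe₃×y` and `φ` a smooth cutoff EQUAL TO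
ONE on the CLOSED final switched region `‖y‖ ≤ √2·ℓ` (NOT the switch weight `σ_s` itself: on the reference the model is tangent, so
switched tangency at time `s` reads `σ_s·(β_j x′×x″ + W_j⊥) = 0`, i.e. FULL local-induction balance wherever `σ_s > 0`; a `σ_s`-weighted
reference under-bends in the collar by a tilt `≈ 0.4·A·Rb²` and misses the true skeleton by `≈ 0.16·A·Rb³·√(log Γ)·√Γ ≫ Rb√Γ`).  With
this frame the leading-order switched problem (exact LIA self-induction, linear strain, model) is solved EXACTLY by the reference for EVERY
`s ∈ [0,1]` (inside the switched region: full LIA balance; outside: the field is `M`, tangent to `x`), so what is left for CONFINEMENT is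
genuinely perturbative in the low band — LIA remainder `O(log log Γ/log Γ)` of the S-bend, mutual-induction mismatch `O(Rb²)` relative,
waist offset `O(1/(Rb√log Γ))` in ball units, i.e. displacements `o(√Γ)` — plus the UNCHANGED ripple-band content of the registered line
(one-way transport at group speed `≍ Γ/μ`, no incoming data, exponentially small band sources; the phase-space map and escape function of
AUDIT-r1g3 §3 apply verbatim) and the unchanged waist analysis (swirl pinning, saddle-focus block).

STUBS (the only `sorry`s): `stub_confinementL` (XL, hardest: THERE IS an admissible frame in which, uniformly in `s ∈ [0,1]` and for all
`Γ ≥ Γ₂(Rb)`, every switched-tangent skeleton of the COARSE shadowing class lies in the FINE class with regular waists),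
`stub_lerayschauderL` (L: the Leray–Schauder alternative for the inflating switch-on in ANY admissible frame), `stub_flatOutputL` (M: a fine
switched-tangent skeleton at `s = 1` in an admissible frame satisfies `FlatJ1L ∧ NearStraightJ1G` with `c = 0`, `Aa ≡ 1`), and the record's
`stub_clause13R` BY NAME (13-R piece, stmt-23612, unchanged, shared).  Composition (REAL proofs): `tangentSkeletonNearStraightLS_of` ⟹ the
child `TangentSkeletonNearStraightL` (stmt-23320) by `Iff.rfl` ⟹ the crux `SkeletonJ1R` through the LANDED split glue
`skeletonJ1R_of_children` (p673130) with the LANDED `NormalBlockMatchedL` (p667604).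

MODEL rung, NEGATIVE side of the ladder: a skeleton registration about a HYPOTHETICAL filament-type rotating-self-similar blow-up skeleton;
nothing here proves or refutes any statement about Navier–Stokes regularity.
-/

set_option linter.dupNamespace false
set_option linter.unusedVariables false

noncomputable section

namespace Summit.NavierStokesRegularity.NavierStokesRegularity.Cruxes.SkeletonJ1R.LiaSwitchoffDegreeR

open Set Function Filter MeasureTheory Real
open Literature.Analysis.FluidPDE
open Summit.NavierStokesRegularity.NavierStokesRegularity.Theses.FilamentSkeletonRss
open Summit.NavierStokesRegularity.NavierStokesRegularity.Theorems.FilamentSkeletonRssSkeletonJ1GSplit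
  (NearStraightJ1G StraightDatum straightDatumGP_exists)
open Summit.NavierStokesRegularity.NavierStokesRegularity.Theorems.FilamentSkeletonRssSkeletonJ1LSplit
  (FlatJ1L TangentSkeletonNearStraightLS route_tangentSkeletonNearStraightL_iff)
open scoped InnerProductSpace Topology BigOperators

/-! ## §1 The switched problem in a reference frame (concrete definitions; `bsField` … `waistPt` verbatim from the registered line) -/

/-- The crux's regularised Biot–Savart field with RIGID UNIT CORES (`Aa ≡ 1`): the `u` of `FlatJ1L`'s hypothesis `hu` at `Aa k σ = 1`. -/
def bsField {N : ℕ} (Γ : ℝ) (γ : Fin N → ℝ) (Z : Fin N → ℝ → EuclideanSpace ℝ (Fin 3)) (y : EuclideanSpace ℝ (Fin 3)) :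
    EuclideanSpace ℝ (Fin 3) :=
  ∑ k, (Γ*γ k/(4*Real.pi)) • ∫ σ:ℝ, ((‖y-Z k σ‖^2+Real.exp (-(1+Real.eulerMascheroniConstant-Real.log 2))*(1:ℝ))^(3/2:ℝ))⁻¹ •
    cross (deriv (Z k) σ) (y-Z k σ)

/-- The TRUE rotating-frame field of the crux (hypothesis `hv` of `FlatJ1L`): `u_X y + ½ y − α e₃ × y`. -/
def trueField {N : ℕ} (Γ : ℝ) (γ : Fin N → ℝ) (α : ℝ) (X : Fin N → ℝ → EuclideanSpace ℝ (Fin 3)) (y : EuclideanSpace ℝ (Fin 3)) :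
    EuclideanSpace ℝ (Fin 3) :=
  bsField Γ γ X y + (1/2:ℝ) • y - α • cross (EuclideanSpace.single 2 1) y

/-- Smooth switch profile: `= 1` on `(-∞, 0]`, `= 0` on `[1, ∞)`, values in `[0,1]` (Mathlib's `Real.smoothTransition`, reflected). -/
def switchProfile (x : ℝ) : ℝ := Real.smoothTransition (1 - x)

/-- Switch weight at homotopy time `s`: `χ(‖y‖²/ℓ² + 1 − 2s)` — identically `0` at `s = 0`; at `s = 1` it is `1` on `‖y‖ ≤ ℓ` and `0` on
`‖y‖ ≥ √2·ℓ`; in between the true field is switched on in the ball `‖y‖² ≤ (2s−1)ℓ²` with a collar out to `‖y‖² = 2sℓ²`. -/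
def switchWeight (ℓ s : ℝ) (y : EuclideanSpace ℝ (Fin 3)) : ℝ := switchProfile (‖y‖ ^ 2 / ℓ ^ 2 + 1 - 2 * s)

/-- Scaled datum waist point `√Γ • (p j + s₀ j • t j)`. -/
def waistPt {N : ℕ} (Γ : ℝ) (p t : Fin N → EuclideanSpace ℝ (Fin 3)) (s₀ : Fin N → ℝ) (j : Fin N) : EuclideanSpace ℝ (Fin 3) :=
  Real.sqrt Γ • (p j + s₀ j • t j)

/-- ADMISSIBLE REFERENCE SKELETON (what the consumers use of it): unit-speed `C²` curves through the scaled datum waists, tilt `≤ Rb/8`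
against the datum directions everywhere, curvature `√Γ‖x″‖ ≤ Rb/2`, pairwise separation `(ρ/2)√Γ`, and INJECTIVE normal tubes of radius
`ρ√Γ/8` (so that a field may be prescribed in normal-disc coordinates and the waist box `ρ√Γ/16` lies in the tube).  The intended instance
is the local-induction reference of the header (S-bend turning `A·Rb² ≤ Rb/8` for `Rb ≤ 1/(8A)`, curvature `2A·Rb/√(log Γ) ≤ Rb/2` for
`log Γ ≥ 16A²`). -/
def AdmissibleReference {N : ℕ} (Γ ρ Rb : ℝ) (p t : Fin N → EuclideanSpace ℝ (Fin 3)) (s₀ : Fin N → ℝ)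
    (x : Fin N → ℝ → EuclideanSpace ℝ (Fin 3)) : Prop :=
  (∀ j, ContDiff ℝ 2 (x j) ∧ (∀ τ, ‖deriv (x j) τ‖ = 1) ∧ x j 0 = waistPt Γ p t s₀ j) ∧
    (∀ j τ, ‖deriv (x j) τ - t j‖ ≤ Rb / 8) ∧ (∀ j τ, ‖iteratedDeriv 2 (x j) τ‖ * Real.sqrt Γ ≤ Rb / 2) ∧
    (∀ j k, j ≠ k → ∀ τ σ, ρ / 2 * Real.sqrt Γ ≤ ‖x j τ - x k σ‖) ∧
    (∀ j k τ σ (z z' : EuclideanSpace ℝ (Fin 3)), ⟪z, deriv (x j) τ⟫_ℝ = 0 → ⟪z', deriv (x k) σ⟫_ℝ = 0 →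
      ‖z‖ ≤ ρ * Real.sqrt Γ / 8 → ‖z'‖ ≤ ρ * Real.sqrt Γ / 8 → x j τ + z = x k σ + z' → j = k ∧ τ = σ ∧ z = z')

/-- ADMISSIBLE OUTER MODEL about a reference `x`: a `C²` field of at most linear growth which, in normal-disc coordinates of radius `ρ√Γ/8`
about each reference curve, IS the linear hyperbolic arm model — axial rate `7/4` along the reference from its waist, normal contraction `λ`:
`M(x_j(τ) + z) = (7/4)τ · x_j′(τ) − λ z` for `z ⊥ x_j′(τ)`, `‖z‖ ≤ ρ√Γ/8`.  In particular `M(x_j 0) = 0` with derivative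
`diag(7/4, −λ, −λ)` in the frame `(x_j′ 0, m, n)`, the reference is the oriented unstable streamline of that zero, and every other
streamline in the tube converges to the reference with slope `−λz/((7/4)τ)` (the exit-data SELECTION used by confinement).  Outside the
tubes `M` is free (the construction blends into `½ y`). -/
def AdmissibleModel {N : ℕ} (Γ ρ lam : ℝ) (x : Fin N → ℝ → EuclideanSpace ℝ (Fin 3))
    (M : EuclideanSpace ℝ (Fin 3) → EuclideanSpace ℝ (Fin 3)) : Prop :=
  ContDiff ℝ 2 M ∧ (∃ C : ℝ, ∀ y, ‖M y‖ ≤ C * (1 + ‖y‖)) ∧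
    ∀ j τ (z : EuclideanSpace ℝ (Fin 3)), ⟪z, deriv (x j) τ⟫_ℝ = 0 → ‖z‖ ≤ ρ * Real.sqrt Γ / 8 →
      M (x j τ + z) = ((7/4:ℝ) * τ) • deriv (x j) τ - lam • z

/-- ADMISSIBLE FRAME = admissible reference + admissible model about it.  It is the SAME for every homotopy time `s` (only the switched-on
ball inflates); it is produced by the confinement prover (`∃` in `ConfinementL`) and consumed by the Leray–Schauder and output stubs (`∀`). -/
def AdmissibleFrame {N : ℕ} (Γ ρ lam Rb : ℝ) (p t : Fin N → EuclideanSpace ℝ (Fin 3)) (s₀ : Fin N → ℝ)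
    (x : Fin N → ℝ → EuclideanSpace ℝ (Fin 3)) (M : EuclideanSpace ℝ (Fin 3) → EuclideanSpace ℝ (Fin 3)) : Prop :=
  AdmissibleReference Γ ρ Rb p t s₀ x ∧ AdmissibleModel Γ ρ lam x M

/-- THE SWITCHED FIELD at homotopy time `s` generated by the skeleton `X` ITSELF, with outer model `M`:
`σ • trueField X y + (1 − σ) • M y`, `σ = switchWeight (Rb√(Γ log Γ)) s y`. -/
def switchedField {N : ℕ} (Γ Rb : ℝ) (γ : Fin N → ℝ) (α : ℝ) (M : EuclideanSpace ℝ (Fin 3) → EuclideanSpace ℝ (Fin 3))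
    (s : ℝ) (X : Fin N → ℝ → EuclideanSpace ℝ (Fin 3)) (y : EuclideanSpace ℝ (Fin 3)) : EuclideanSpace ℝ (Fin 3) :=
  switchWeight (Rb * Real.sqrt (Γ * Real.log Γ)) s y • trueField Γ γ α X y +
    (1 - switchWeight (Rb * Real.sqrt (Γ * Real.log Γ)) s y) • M y

/-- SWITCHED-TANGENT SKELETON at time `s` (verbatim shape of the registered line, model `M`): unit-speed `C²` curves, each GLOBALLY tangent to
the switched field it generates, through a zero of that field at parameter `0` (the waist), switched slip `≤ 0` before and `≥ 0` after the
waist (closed conditions), escaping to infinity. -/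
def SwitchedTangent {N : ℕ} (Γ Rb : ℝ) (γ : Fin N → ℝ) (α : ℝ) (M : EuclideanSpace ℝ (Fin 3) → EuclideanSpace ℝ (Fin 3))
    (s : ℝ) (X : Fin N → ℝ → EuclideanSpace ℝ (Fin 3)) : Prop :=
  ∀ j, ContDiff ℝ 2 (X j) ∧ (∀ τ, ‖deriv (X j) τ‖ = 1) ∧
    (∀ τ, switchedField Γ Rb γ α M s X (X j τ) = ⟪switchedField Γ Rb γ α M s X (X j τ), deriv (X j) τ⟫_ℝ • deriv (X j) τ) ∧
    switchedField Γ Rb γ α M s X (X j 0) = 0 ∧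
    (∀ τ, 0 ≤ τ → 0 ≤ ⟪switchedField Γ Rb γ α M s X (X j τ), deriv (X j) τ⟫_ℝ) ∧
    (∀ τ, τ ≤ 0 → ⟪switchedField Γ Rb γ α M s X (X j τ), deriv (X j) τ⟫_ℝ ≤ 0) ∧
    Tendsto (fun τ => ‖X j τ‖) (cocompact ℝ) atTop

/-- COARSE SHADOWING CLASS about the reference `x`: every point of `X j` lies within `ρ√Γ/16` of a point of `x j` whose tangent is within
`Rb/2` of the tangent of `X j` there, and the waist `X j 0` lies within `ρ√Γ/16` of the reference waist `x j 0` (inside the injective model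
tube of radius `ρ√Γ/8`, containing the waist box). -/
def CoarseClass {N : ℕ} (Γ ρ Rb : ℝ) (x X : Fin N → ℝ → EuclideanSpace ℝ (Fin 3)) : Prop :=
  ∀ j, (∀ τ, ∃ σ, ‖X j τ - x j σ‖ ≤ ρ * Real.sqrt Γ / 16 ∧ ‖deriv (X j) τ - deriv (x j) σ‖ ≤ Rb / 2) ∧
    ‖X j 0 - x j 0‖ ≤ ρ * Real.sqrt Γ / 16

/-- FINE SHADOWING CLASS (the a priori bounds) about the reference `x`: position `≤ Rb√Γ`, tilt `≤ Rb/4` against the shadowing reference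
tangent, waist displacement `≤ Rb√Γ`, curvature `√Γ‖X″‖ ≤ Rb`, and the TRUE slip `w = ⟪trueField X (X j τ), X j′ τ⟫` is differentiable with
slope in `[3/2 + δ/2, Λ + 1]` at the waist and `|w′| ≤ Λ + 1` everywhere (verbatim slip clauses of the registered line). -/
def FineClass {N : ℕ} (Γ δ Λ Rb : ℝ) (γ : Fin N → ℝ) (α : ℝ) (x X : Fin N → ℝ → EuclideanSpace ℝ (Fin 3)) : Prop :=
  ∀ j, (∀ τ, ∃ σ, ‖X j τ - x j σ‖ ≤ Rb * Real.sqrt Γ ∧ ‖deriv (X j) τ - deriv (x j) σ‖ ≤ Rb / 4) ∧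
    ‖X j 0 - x j 0‖ ≤ Rb * Real.sqrt Γ ∧ (∀ τ, ‖iteratedDeriv 2 (X j) τ‖ * Real.sqrt Γ ≤ Rb) ∧
    Differentiable ℝ (fun τ => ⟪trueField Γ γ α X (X j τ), deriv (X j) τ⟫_ℝ) ∧
    3/2 + δ/2 ≤ deriv (fun τ => ⟪trueField Γ γ α X (X j τ), deriv (X j) τ⟫_ℝ) 0 ∧
    (∀ τ, |deriv (fun τ => ⟪trueField Γ γ α X (X j τ), deriv (X j) τ⟫_ℝ) τ| ≤ Λ + 1)

/-- REGULAR WAIST at time `s` (verbatim shape of the registered line, in the reference frame): in the waist box of radius `ρ√Γ/16` about the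
reference waist `x j 0` the switched field vanishes ONLY at `X j 0`, the switched slip along `X j` vanishes ONLY at `τ = 0`, and the derivative
of the switched field at the waist has `X j′ 0` as an eigenvector with positive eigenvalue and a normal block of negative trace and positive
determinant (saddle-focus, the clause-12 shape of the landed `NormalBlockMatchedL`).  At `s = 0` (field `= M`) this is the explicit arm-model
computation `diag(7/4, −λ, −λ)`. -/
def RegularWaist {N : ℕ} (Γ ρ Rb : ℝ) (γ : Fin N → ℝ) (α : ℝ) (x : Fin N → ℝ → EuclideanSpace ℝ (Fin 3))
    (M : EuclideanSpace ℝ (Fin 3) → EuclideanSpace ℝ (Fin 3)) (s : ℝ) (X : Fin N → ℝ → EuclideanSpace ℝ (Fin 3)) : Prop :=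
  ∀ j, (∀ y, ‖y - x j 0‖ ≤ ρ * Real.sqrt Γ / 16 → switchedField Γ Rb γ α M s X y = 0 → y = X j 0) ∧
    (∀ τ, ⟪switchedField Γ Rb γ α M s X (X j τ), deriv (X j) τ⟫_ℝ = 0 → τ = 0) ∧
    ∃ (A : EuclideanSpace ℝ (Fin 3) →L[ℝ] EuclideanSpace ℝ (Fin 3)) (m n : EuclideanSpace ℝ (Fin 3)),
      A = fderiv ℝ (switchedField Γ Rb γ α M s X) (X j 0) ∧ Orthonormal ℝ ![deriv (X j) 0, m, n] ∧
      A (deriv (X j) 0) = ⟪A (deriv (X j) 0), deriv (X j) 0⟫_ℝ • deriv (X j) 0 ∧ 0 < ⟪A (deriv (X j) 0), deriv (X j) 0⟫_ℝ ∧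
      ⟪A m, m⟫_ℝ + ⟪A n, n⟫_ℝ < 0 ∧ ⟪A n, m⟫_ℝ * ⟪A m, n⟫_ℝ < ⟪A m, m⟫_ℝ * ⟪A n, n⟫_ℝ

/-! ### Sanity (sorry-free): at homotopy time `0` the switch weight vanishes identically — the base point of the index is the pure model
problem, whose switched-tangent skeleton in any admissible frame is the reference itself. -/

theorem switchWeight_zero (ℓ : ℝ) (y : EuclideanSpace ℝ (Fin 3)) : switchWeight ℓ 0 y = 0 := by
  unfold switchWeight switchProfile
  apply Real.smoothTransition.zero_of_nonpos
  have : 0 ≤ ‖y‖ ^ 2 / ℓ ^ 2 := by positivity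
  linarith

theorem switchedField_zero_eq_model {N : ℕ} (Γ Rb : ℝ) (γ : Fin N → ℝ) (α : ℝ)
    (M : EuclideanSpace ℝ (Fin 3) → EuclideanSpace ℝ (Fin 3)) (X : Fin N → ℝ → EuclideanSpace ℝ (Fin 3)) (y : EuclideanSpace ℝ (Fin 3)) :
    switchedField Γ Rb γ α M 0 X y = M y := by
  simp [switchedField, switchWeight_zero]

/-! ## §2 The stub STATEMENTS (named `Prop`s; the stubs in §3 assert them) -/

/-- STUB C statement · A PRIORI CONFINEMENT IN A REFERENCE FRAME OF THE PROVER'S CHOOSING (XL — THE HARD STUB).  For every general-position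
straight datum there are a contraction rate `λ` and a tolerance ceiling `Rb₁` such that for every `Rb ≤ Rb₁` and all `Γ ≥ Γ₂(Rb)` THERE IS an
admissible frame `(x, M)` in which, UNIFORMLY IN `s ∈ [0,1]`, every switched-tangent skeleton of the COARSE shadowing class lies in the FINE
class and has REGULAR waists.  Intended frame: the local-induction reference of the header (full LIA balance on the closed final switched
region, shot from the datum waists in the datum directions, the other datum lines' Biot–Savart field included) with the arm model in its
tube coordinates; at `s = 0` the reference itself is the (only) coarse switched-tangent skeleton and the claim is the slip computation along
it.  Content (line card §Stubs): (i) LOW BAND — the in-ball equation for the offset `Y = X − x` is the local-induction operator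
`β_jσ_s Y″ − F_∥Y′ + O(1)·Y = σ_s·(LIA remainder + mutual mismatch)`, right side `o(β√Γ/ℓ²)`, exit data selected by the model slope at both
arm ends (two conditions per end = the four in-ball parameters; the matching determinant `≍ τ_e²(1 + 4λ/7)²` at the reference), no conjugate
points since strain/stiffness `≈ 2A·Rb² ≪ 1` on the ball: sup-norm gain `8πRb²/γ_j`, Γ-uniform; (ii) RIPPLE EXCLUSION for the shell band
`kμ ≈ κ*` exactly as in the registered line (one-way transport at group speed `≍ Γ/μ ≫ |w|`, no incoming data beyond the switch,
exponentially small band sources and feedback gain; non-trapping escape function `{p_s, log|ξ|} = w′ − w(log S_s)′ > 0`, AUDIT-r1g3 §3.4);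
(iii) collar slaving where `σ_s → 0` (the stiffness `β_jσ_s` degenerates, bounded solutions take the model slope); (iv) waist regularity at
every `s` (swirl pinning + the saddle-focus block, mechanism of the landed `NormalBlockMatchedL`, for the mixed field). -/
def ConfinementL : Prop :=
  ∀ (N : ℕ) (δd ρd Λd Rwd θd mw : ℝ) (p t : Fin N → EuclideanSpace ℝ (Fin 3)) (γ : Fin N → ℝ) (α : ℝ) (s₀ : Fin N → ℝ),
    0 < N → 0 < δd → 0 < ρd → 0 < Rwd → 0 < θd → 0 < mw → StraightDatum N δd ρd Λd Rwd θd mw p t γ α s₀ →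
    (∀ j k, j ≠ k → |⟪t j, t k⟫_ℝ| ≤ 1 - θd) →
    ∃ (lam Rb₁ : ℝ), 0 < lam ∧ 0 < Rb₁ ∧ ∀ Rb : ℝ, 0 < Rb → Rb ≤ Rb₁ → ∃ Γ₂ : ℝ, ∀ Γ : ℝ, Γ₂ ≤ Γ →
      ∃ (x : Fin N → ℝ → EuclideanSpace ℝ (Fin 3)) (M : EuclideanSpace ℝ (Fin 3) → EuclideanSpace ℝ (Fin 3)),
        AdmissibleFrame Γ ρd lam Rb p t s₀ x M ∧
        ∀ s : ℝ, 0 ≤ s → s ≤ 1 → ∀ X : Fin N → ℝ → EuclideanSpace ℝ (Fin 3),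
          CoarseClass Γ ρd Rb x X → SwitchedTangent Γ Rb γ α M s X →
            FineClass Γ δd Λd Rb γ α x X ∧ RegularWaist Γ ρd Rb γ α x M s X

/-- STUB B statement · THE LERAY–SCHAUDER ALTERNATIVE FOR THE INFLATING SWITCH-ON, IN ANY ADMISSIBLE FRAME (L; classical functional analysis, Mathlib
has no Leray–Schauder degree).  At FIXED `Γ` (large), `λ`, `Rb ≤ ρ/32` and a fixed admissible frame: if, for every `s ∈ [0,1]`, every
switched-tangent skeleton in the coarse class is fine with regular waists, then a fine switched-tangent skeleton with regular waists EXISTS at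
`s = 1`.  Content: ambient space `E` = `C¹` curves on a Γ-dependent parameter window, continued outside by the model streamlines; ONE open set
`U` (tolerances strictly between FINE and COARSE about `x`, which is fixed in `s`; plus: exactly one zero of the switched field in each waist
box, hyperbolic of type (1 unstable, 2 stable)); `Φ^s(X)` = arclength parametrisation from the waist zero of the global UNSTABLE STREAMLINE of
the switched field generated by `X` — compact, continuous in `(s, X)`, and at `s = 0` CONSTANT `= x` (the switch weight vanishes,
`switchedField_zero_eq_model`; the unstable streamlines of `M` from its waist zeros are the reference curves, `AdmissibleModel`), where `x`
itself is coarse and switched-tangent, hence fine with regular waists BY THE HYPOTHESIS at `s = 0`; `Fix Φ^s ∩ U` = the switched-tangent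
skeletons in `U`; the hypothesis makes the fixed-point set compact in `[0,1] × U`, so the fixed-point index is constant `= 1`
(Granas–Dugundji §12; Leray–Schauder 1934; Schaefer 1955). -/
def LeraySchauderL : Prop :=
  ∀ (N : ℕ) (δd ρd Λd Rwd θd mw : ℝ) (p t : Fin N → EuclideanSpace ℝ (Fin 3)) (γ : Fin N → ℝ) (α : ℝ) (s₀ : Fin N → ℝ),
    0 < N → 0 < δd → 0 < ρd → 0 < Rwd → 0 < θd → 0 < mw → StraightDatum N δd ρd Λd Rwd θd mw p t γ α s₀ →
    (∀ j k, j ≠ k → |⟪t j, t k⟫_ℝ| ≤ 1 - θd) →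
    ∀ lam Rb : ℝ, 0 < lam → 0 < Rb → Rb ≤ ρd / 32 → ∃ Γ₁ : ℝ, ∀ Γ : ℝ, Γ₁ ≤ Γ →
      ∀ (x : Fin N → ℝ → EuclideanSpace ℝ (Fin 3)) (M : EuclideanSpace ℝ (Fin 3) → EuclideanSpace ℝ (Fin 3)),
        AdmissibleFrame Γ ρd lam Rb p t s₀ x M →
        (∀ s : ℝ, 0 ≤ s → s ≤ 1 → ∀ X : Fin N → ℝ → EuclideanSpace ℝ (Fin 3),
          CoarseClass Γ ρd Rb x X → SwitchedTangent Γ Rb γ α M s X →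
            FineClass Γ δd Λd Rb γ α x X ∧ RegularWaist Γ ρd Rb γ α x M s X) →
        ∃ X : Fin N → ℝ → EuclideanSpace ℝ (Fin 3),
          FineClass Γ δd Λd Rb γ α x X ∧ SwitchedTangent Γ Rb γ α M 1 X ∧ RegularWaist Γ ρd Rb γ α x M 1 X

/-- STUB D statement · FLAT OUTPUT (M; bookkeeping + one far-field estimate).  A FINE switched-tangent skeleton at `s = 1` with regular waists, in an
admissible frame, satisfies the flat clause block `FlatJ1L` and the near-straight regime `NearStraightJ1G` with `c := 0`, rigid unit cores
`Aa := 1` (`KA := 1`), `w :=` the TRUE slip, and datum-derived constants: on the crux ball the switch weight is `1`, so global switched tangency IS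
clause 9; tangent oscillation `≤ Rb` from tilt `≤ Rb/4` against the reference and reference tilt `≤ Rb/8` against `t j` (`AdmissibleReference`);
separation `(ρ/2 − 2Rb)√Γ`; chord–arc / box / waist-norm / tilt / cone clauses are inequalities on the fine class, `AdmissibleReference` and
`StraightDatum`; the unique zero of the TRUE slip off the ball needs `½⟪X, X′⟫ > |α|·|⟪e₃ × X, X′⟫| + |⟪u_X, X′⟫|` (centreline Biot–Savart bound
`|u_X(X j τ)| ≤ C√Γ log Γ` along near-straight separated skeletons). -/
def FlatOutputL : Prop :=
  ∀ (N : ℕ) (δd ρd Λd Rwd θd mw : ℝ) (p t : Fin N → EuclideanSpace ℝ (Fin 3)) (γ : Fin N → ℝ) (α : ℝ) (s₀ : Fin N → ℝ),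
    0 < N → 0 < δd → 0 < ρd → 0 < Rwd → 0 < θd → 0 < mw → StraightDatum N δd ρd Λd Rwd θd mw p t γ α s₀ →
    (∀ j k, j ≠ k → |⟪t j, t k⟫_ℝ| ≤ 1 - θd) →
    ∃ (δ ρ K Λ Rw cg θ₀ KA Rb₁ : ℝ), 0 < δ ∧ 0 < ρ ∧ 0 < Rw ∧ 0 < cg ∧ 0 < θ₀ ∧ 0 < Rb₁ ∧ 2 * K * ρ ≤ 1 ∧
      ∀ lam Rb : ℝ, 0 < lam → 0 < Rb → Rb ≤ Rb₁ → ∃ Γ₃ : ℝ, ∀ Γ : ℝ, Γ₃ ≤ Γ →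
        ∀ (x : Fin N → ℝ → EuclideanSpace ℝ (Fin 3)) (M : EuclideanSpace ℝ (Fin 3) → EuclideanSpace ℝ (Fin 3)),
          AdmissibleFrame Γ ρd lam Rb p t s₀ x M →
          ∀ X : Fin N → ℝ → EuclideanSpace ℝ (Fin 3),
            FineClass Γ δd Λd Rb γ α x X → SwitchedTangent Γ Rb γ α M 1 X → RegularWaist Γ ρd Rb γ α x M 1 X →
            ∃ (w : Fin N → ℝ → ℝ) (c : Fin N → ℝ) (Aa : Fin N → ℝ → ℝ),
              FlatJ1L N δ ρ K Λ Rw Rb cg θ₀ KA Γ γ α X w c Aa ∧ NearStraightJ1G N Λ Rb X w Aa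

/-! ## §3 The stubs (the ONLY `sorry`s of this file) + the record's 13-R stub BY NAME -/

/-- STUB C · `stub_confinementL` · XL · THE HARDEST (it also CONSTRUCTS the frame).  Why it might fail: (a) a HIGH-Q RIPPLE CAVITY — if the collar
folds reflected the `κ*` band into a branch that re-converts at O(1) rate the injectivity estimate would degrade to `1/dist(Γ, resonances)`
(AUDIT-r1g3 §3: the bicharacteristic flow is non-trapping for every `s`, so this can only come from sub-principal terms); (b) at intermediate
`s` the waist box carries the MIXED field `σ_s v_X + (1−σ_s)M` with `σ_s(waist) = χ(1−2s) ∈ (0,1)` and extra zeros could enter unless `λ` is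
large against the datum's normal velocities; (c) the matching of the four in-ball parameters to the model slope at the two arm ends is a 4×4
system with determinant `≍ τ_e²(1 + 4λ/7)²` at the reference — it must stay invertible along the whole coarse class; (d) the frame itself: the
local-induction reference must satisfy `AdmissibleReference` (tilt `A·Rb² ≤ Rb/8`, curvature `2A Rb/√log Γ ≤ Rb/2`, injective tubes from
`radius·curvature ≤ ρRb/16` + the tilt bound) — elementary, but the cutoff `φ` must be `1` on the CLOSED final switched region (header).
[Leray–Schauder a priori method; local induction: Majda–Bertozzi 2002 §7.1; Kelvin-wave symbol `m(kμ)` (censuses g1/g2, `liaSym` p656939);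
Fukumoto–Miyazaki 1991; Widnall–Bliss–Zalay 1971 (`κ*`)] -/
theorem stub_confinementL : ConfinementL := by
  sorry

/-- STUB B · `stub_lerayschauderL` · L · existence by topology.  Why it might fail: the unstable-streamline map must be a well-defined compact map on a
whole open neighbourhood of the fine class, continuously in `s` (needs the frame's `C¹`-continuity in `s` and Γ-dependent bounds only), and limits of
switched-tangent skeletons must be switched-tangent (closed conditions only — the non-strict slip signs in `SwitchedTangent`; strict facts live in
`RegularWaist`).  Formalisation-heavy (no LS degree in Mathlib), mathematically classical.  [Leray–Schauder, Ann. ÉNS 51 (1934) 45–78; Schaefer, Math.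
Ann. 129 (1955) 415–416; Granas–Dugundji, Fixed Point Theory (2003) §§10–12] -/
theorem stub_lerayschauderL : LeraySchauderL := by
  sorry

/-- STUB D · `stub_flatOutputL` · M · bookkeeping into `FlatJ1L ∧ NearStraightJ1G` (`c := 0`, `Aa := 1`, `KA := 1`, `w :=` true slip, `δ := δd/2`,
`ρ := min (ρd/4) (1/2)`, `K := Rb₁`, `Λ := Λd + 1`, `Rw := Rwd + 1`, `θ₀ := θd/2`, `cg := 1/2`) plus the far-slip positivity estimate.  Why it might
fail: only through a mis-set constant (then re-set it); the one analytic input is the centreline Biot–Savart bound.  [the flat clause list of the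
route decl `TangentSkeletonNearStraightL`; Majda–Bertozzi 2002 §7.1 for the matched-core centreline field] -/
theorem stub_flatOutputL : FlatOutputL := by
  sorry

/-- The record's 13-R stub BY NAME AND SIGNATURE (piece 2 of the split of record, stmt-NavierStokesRegularity-23612; unchanged by this line, shared
with `switchoff_degree_R.lean`, `near_straight_newton_R.lean` and `adjoint_rate_R.lean`). -/
theorem stub_clause13R :
    Summit.NavierStokesRegularity.NavierStokesRegularity.Theses.FilamentSkeletonRss.Clause13RNearStraightL := by
  sorry

/-- Piece 3 of the split of record — DISCHARGED BY NAME: `NormalBlockMatchedL` (stmt-23322) is a theorem in the tree (p667604). No `sorry`. -/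
theorem normalBlockL_landed :
    Summit.NavierStokesRegularity.NavierStokesRegularity.Theses.FilamentSkeletonRss.NormalBlockMatchedL :=
  Summit.NavierStokesRegularity.NavierStokesRegularity.Theorems.FilamentSkeletonRssNormalBlockMatchedL.stub_normalBlockL

/-! ## §4 Composition (REAL proofs, no stub constant used until `SkeletonJ1R_of`) -/

/-- COMPOSITION over the three stub STATEMENTS: confinement (C) fixes `λ`, builds the frame at every `Γ ≥ Γ₂` and feeds the Leray–Schauder
alternative (B) inside it; the fixed point is booked by (D).  Constants threaded: `Rb₁ := min Rb₁ᴰ (min Rb₁ᶜ (ρd/32))`,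
`Γ₂ := max Γ₂ᶜ (max Γ₁ᴮ Γ₃ᴰ)`. -/
theorem tangentSkeletonNearStraightLS_of (hC : ConfinementL) (hB : LeraySchauderL) (hD : FlatOutputL) :
    TangentSkeletonNearStraightLS := by
  intro N δd ρd Λd Rwd θd mw p t γ α s₀ hN hδ hρ hRw hθ hmw hSD hGP
  obtain ⟨δ, ρ, K, Λ, Rw, cg, θ₀, KA, RbD, hδ', hρ', hRw', hcg, hθ₀', hRbD, hKρ, hDfam⟩ :=
    hD N δd ρd Λd Rwd θd mw p t γ α s₀ hN hδ hρ hRw hθ hmw hSD hGP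
  obtain ⟨lam, RbC, hlam, hRbC, hCfam⟩ := hC N δd ρd Λd Rwd θd mw p t γ α s₀ hN hδ hρ hRw hθ hmw hSD hGP
  have hρ32 : 0 < ρd / 32 := by positivity
  refine ⟨δ, ρ, K, Λ, Rw, cg, θ₀, KA, min RbD (min RbC (ρd / 32)), hδ', hρ', hRw', hcg, hθ₀',
    lt_min hRbD (lt_min hRbC hρ32), hKρ, ?_⟩
  intro Rb hRb hRb₁
  have hRbD' : Rb ≤ RbD := le_trans hRb₁ (min_le_left _ _)
  have hRbC' : Rb ≤ RbC := le_trans hRb₁ (le_trans (min_le_right _ _) (min_le_left _ _))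
  have hRbρ : Rb ≤ ρd / 32 := le_trans hRb₁ (le_trans (min_le_right _ _) (min_le_right _ _))
  obtain ⟨Γ₂, hconf⟩ := hCfam Rb hRb hRbC'
  obtain ⟨Γ₁, hls⟩ := hB N δd ρd Λd Rwd θd mw p t γ α s₀ hN hδ hρ hRw hθ hmw hSD hGP lam Rb hlam hRb hRbρ
  obtain ⟨Γ₃, hout⟩ := hDfam lam Rb hlam hRb hRbD'
  refine ⟨max Γ₂ (max Γ₁ Γ₃), fun Γ hΓ => ?_⟩
  have hΓ₂ : Γ₂ ≤ Γ := le_trans (le_max_left _ _) hΓ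
  have hΓ₁ : Γ₁ ≤ Γ := le_trans (le_trans (le_max_left _ _) (le_max_right _ _)) hΓ
  have hΓ₃ : Γ₃ ≤ Γ := le_trans (le_trans (le_max_right _ _) (le_max_right _ _)) hΓ
  obtain ⟨x, M, hxM, hconfs⟩ := hconf Γ hΓ₂
  obtain ⟨X, hfine, htan, hreg⟩ := hls Γ hΓ₁ x M hxM hconfs
  obtain ⟨w, c, Aa, hflat, hns⟩ := hout Γ hΓ₃ x M hxM X hfine htan hreg
  exact ⟨X, w, c, Aa, hflat, hns⟩

/-- The child of record `TangentSkeletonNearStraightL` (stmt-NavierStokesRegularity-23320, the heart) from the four stub statements — by the landed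
certificate `route_tangentSkeletonNearStraightL_iff` (`Iff.rfl`).  Real proof. -/
theorem tangentSkeletonNearStraightL_of_hyps (hC : ConfinementL) (hB : LeraySchauderL) (hD : FlatOutputL) :
    Summit.NavierStokesRegularity.NavierStokesRegularity.Theses.FilamentSkeletonRss.TangentSkeletonNearStraightL :=
  route_tangentSkeletonNearStraightL_iff.mpr (tangentSkeletonNearStraightLS_of hC hB hD)

/-- **THE SKELETON THEOREM — the crux `FilamentSkeletonRss.SkeletonJ1R` (stmt-NavierStokesRegularity-23610) BY NAME**, through the LANDED split glue
`skeletonJ1R_of_children` (p673130): heart from the confinement / Leray–Schauder / output stubs, 13-R from the shared record stub, normal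
block landed.  Closed modulo the four stub `sorry`s only. -/
theorem SkeletonJ1R_of : Summit.NavierStokesRegularity.NavierStokesRegularity.Theses.FilamentSkeletonRss.SkeletonJ1R :=
  Summit.NavierStokesRegularity.NavierStokesRegularity.Theorems.FilamentSkeletonRssSkeletonJ1RSplit.skeletonJ1R_of_children
    (tangentSkeletonNearStraightL_of_hyps stub_confinementL stub_lerayschauderL stub_flatOutputL) stub_clause13R
    normalBlockL_landed

end Summit.NavierStokesRegularity.NavierStokesRegularity.Cruxes.SkeletonJ1R.LiaSwitchoffDegreeR

end
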